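import Summits.QuantumFields.YangMills.Theorems.AlphaInputsT3ACv3StartRows
import HarnessLib

/-!
# `AlphaInputsT3ACv3HLiftWindowRows` — MAP #3 M22, the (FL) `hLift` clause for `16 ≤ L^k`: **THE NUMERAL ROWS OF THE REGIONAL NEWTON LIFT ON THE WINDOW `ε′ ≤ 1∕(10³⁴·L)`** — at `d = 3`,
# `|n| = 2`, with the M22 letters `t := 84480·(83559424ε′)`, `x := L^k·(D·δ₀)`, `η₀ := 2(d+1)L^k·(D·δ₀)`, `ω := 2Dδ₀·(d⌊L^k∕2⌋)`, `κ := ((d+1)L^k)·((1056∕L^k)·2ω)`, `η_p := D₂·δ₀`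
# (`D = d⌊L^k∕2⌋ + L^k`, `D₂ = d⌊L^k∕2⌋ + 2L^k`, `δ₀ ≤ 83559424ε′∕L^{2k}` the START's plaquette number), EVERY smallness row of ★w4 g2's `exists_exact_lift_regional_window_kfree` ((K1)–(K7)),
# the three (S6) rows of `startT3_cert`, and the scale rows (`δ₀ ≤ B₀ε′∕L^{2k}`, `η₀ ≤ A₀ε′`, `η_p ≤ A₁ε′∕L^k`, `C_curl ≤ 1729`, `B_tot < 10²⁷`) FOLLOW from the ONE window
# `ε′ ≤ 1∕(10³⁴·L)` — lane `pub-balaban3d` ∕ cell `ym3-torus`, seat `ym-ust-19936-w4` (g3)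

WHY (cell `ym3-torus` 2026-08-28: ★★OWNER g25 RULING (FL-SMALL) 03:29:46Z «every (FL) knit carries the explicit binder `(hε : ε′ ≤ ε_FL)` with `ε_FL` a CLOSED NUMERAL»; (J) 03:44:03Z «the M22
skeleton `hLift_clause_of_start` … from DISPLAYED START rows + (K1)–(K7) = ★w4»).  Rows (K2), (K3) of (H) and `h32`∕`hNδ` of (S6) carry a bare factor `ℓ = (d+2)L`, so the window is
`ε_FL(L) = 1∕(10³⁴·L)` (for the family's fixed `L`; the knit `innerFineLiftsT3_of_regionalLifts_window` accepts any real `εFL`).  Real arithmetic only; generic `P` with `P.d = 3`, `3 ≤ P.L`.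
WHAT (def-free): `window_eps` (ε′-sizes), `window_geom` (`d⌊L^k∕2⌋ ≤ 3L^k∕2`, `D ≤ 5L^k∕2`, `D₂ ≤ 7L^k∕2`), `window_frac` (`5200ℓ²∕(L(L−1)) ≤ 195000`, `324ℓ²∕(L(L−1)) ≤ 12150`),
`window_letters` (`x ≤ 5E∕2`, `η₀ = 8x`, `ω ≤ 15E∕2`, `κ = 8448ω`, `E = 83559424ε′`), ★★ `window_Krows` ((K1)–(K7) in the syntactic shape of `exists_exact_lift_regional_window_kfree` at
`C_R = 1056`), ★ `window_S6rows`, ★ `window_scales`.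
HONEST FRAMING.  Numerals only; `hLift`, the stub 2′χ, the crux `HistoryTailL` and any gap are NOT claimed; count-neutral helper toward R3 2′ (items 19936∕19935); registry untouched;
nothing about d = 4, the continuum, or a mass gap; YM₃ on T³ is rung R3, not Clay.

References: T. Bałaban, Commun. Math. Phys. 102 (1985) 277–309 [Balaban1985Variational] (Thm 1 (8) p.279, (11)–(15) pp.279–280); CMP 98 (1985) 17–51 [Balaban1985Averaging]
(Props. 4–5 pp.38–42).
-/

set_option autoImplicit false

noncomputable section

namespace Summit.QuantumFields.YangMills.Theorems.TubeStart

open Literature.MathematicalPhysics.QuantumFieldTheory.Balaban1983to89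
open ExpMeanLog (deltaSU)

variable (P : Params) (k : ℕ)

/-! ## §1 Sizes of the window -/

/-- **THE WINDOW's ε′-SIZES** (`3 ≤ L`, `0 < ε′ ≤ 1∕(10³⁴L)`): `ε′ ≤ 10⁻⁵`, `ε′ ≤ 1∕4`, `ε′ ≤ 1`, `E := 83559424ε′ ≤ 3∕10²⁷`, `L·E ≤ 1∕10²⁶`. [folklore] -/
theorem window_eps (hL3 : 3 ≤ P.L) {ε' : ℝ} (hε : 0 < ε') (hεL : ε' ≤ 1 / (10 ^ 34 * (P.L : ℝ))) :
    ε' ≤ 1 / 100000 ∧ ε' ≤ 1 / 4 ∧ ε' ≤ 1 ∧ 83559424 * ε' ≤ 3 / 10 ^ 27 ∧ (P.L : ℝ) * (83559424 * ε') ≤ 1 / 10 ^ 26 := by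
  have hL : (3 : ℝ) ≤ (P.L : ℝ) := by exact_mod_cast hL3
  have hLpos : (0 : ℝ) < 10 ^ 34 * (P.L : ℝ) := by positivity
  have hmain : ε' * (10 ^ 34 * (P.L : ℝ)) ≤ 1 := (le_div_iff₀ hLpos).1 hεL
  have h3 : ε' * (3 * 10 ^ 34) ≤ 1 := le_trans (by nlinarith [hε.le]) hmain
  refine ⟨by nlinarith, by nlinarith, by nlinarith, by nlinarith, by nlinarith⟩

/-- **THE GEOMETRY LETTERS** (`d = 3`): `d⌊L^k∕2⌋ ≤ 3L^k∕2`, `D = d⌊L^k∕2⌋ + L^k ≤ 5L^k∕2`, `D₂ = d⌊L^k∕2⌋ + 2L^k ≤ 7L^k∕2`, and `((L^k : ℕ) : ℝ) = L^k`. [folklore] -/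
theorem window_geom (hd3 : P.d = 3) : ((P.d * (P.L ^ k / 2) : ℕ) : ℝ) ≤ 3 / 2 * (P.L : ℝ) ^ k ∧ ((P.d * (P.L ^ k / 2) + P.L ^ k : ℕ) : ℝ) ≤ 5 / 2 * (P.L : ℝ) ^ k ∧
    ((P.d * (P.L ^ k / 2) + 2 * P.L ^ k : ℕ) : ℝ) ≤ 7 / 2 * (P.L : ℝ) ^ k ∧ ((P.L ^ k : ℕ) : ℝ) = (P.L : ℝ) ^ k := by
  have hcast : ((P.L ^ k : ℕ) : ℝ) = (P.L : ℝ) ^ k := by push_cast; ring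
  have hhalf : (((P.L ^ k / 2 : ℕ) : ℕ) : ℝ) * 2 ≤ ((P.L ^ k : ℕ) : ℝ) := by exact_mod_cast Nat.div_mul_le_self (P.L ^ k) 2
  rw [hd3]
  refine ⟨?_, ?_, ?_, hcast⟩ <;> · push_cast; rw [← hcast]; linarith

/-- **THE TWO `L`-FRACTIONS** (`d = 3`, `3 ≤ L`): `5200ℓ²∕(L(L−1)) ≤ 195000` and `324ℓ²∕(L(L−1)) ≤ 12150`, `ℓ = (d+2)L = 5L`. [folklore] -/
theorem window_frac (hd3 : P.d = 3) (hL3 : 3 ≤ P.L) :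
    5200 * (((P.d + 2) * P.L : ℕ) : ℝ) ^ 2 / ((P.L : ℝ) * ((P.L : ℝ) - 1)) ≤ 195000 ∧ 324 * (((P.d + 2) * P.L : ℕ) : ℝ) ^ 2 / ((P.L : ℝ) * ((P.L : ℝ) - 1)) ≤ 12150 := by
  have hL : (3 : ℝ) ≤ (P.L : ℝ) := by exact_mod_cast hL3
  have hden : (0 : ℝ) < (P.L : ℝ) * ((P.L : ℝ) - 1) := by nlinarith
  rw [hd3]
  push_cast
  constructor
  · rw [div_le_iff₀ hden]; nlinarith
  · rw [div_le_iff₀ hden]; nlinarith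

/-! ## §2 The M22 letters on the window -/

/-- **THE LETTER BOUNDS** (`d = 3`, `1 ≤ L`, `0 ≤ δ₀ ≤ 83559424ε′∕L^{2k}`), `E := 83559424ε′`: `L^{2k}δ₀ ≤ E`, `0 ≤ x ≤ 5E∕2`, `η₀ = 8x`, `0 ≤ ω ≤ 15E∕2`, `κ = 8448ω`, `(d+1)L^k(Dδ₀) = 4x`,
`η_p·L^k ≤ 7E∕2`. [folklore] -/
theorem window_letters (hd3 : P.d = 3) {ε' δ₀ t x η₀ ω κ : ℝ} (hδ₀ : 0 ≤ δ₀) (hδ₀B : δ₀ ≤ 83559424 * ε' / ((P.L ^ k : ℕ) : ℝ) ^ 2)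
    (hx : x = (P.L : ℝ) ^ k * ((((P.d * (P.L ^ k / 2) + P.L ^ k : ℕ)) : ℝ) * δ₀))
    (hη₀ : η₀ = 2 * (((P.d : ℝ) + 1) * (P.L : ℝ) ^ k * ((((P.d * (P.L ^ k / 2) + P.L ^ k : ℕ)) : ℝ) * δ₀)))
    (hω : ω = ((((P.d * (P.L ^ k / 2) + P.L ^ k : ℕ)) : ℝ) * δ₀ + (((P.d * (P.L ^ k / 2) + P.L ^ k : ℕ)) : ℝ) * δ₀) * (((P.d * (P.L ^ k / 2) : ℕ)) : ℝ))
    (hκ : κ = (((P.d : ℝ) + 1) * (P.L : ℝ) ^ k) * ((1056 / (P.L : ℝ) ^ k) * (2 * ω))) (_ht : t = 84480 * (83559424 * ε')) :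
    ((P.L : ℝ) ^ k) ^ 2 * δ₀ ≤ 83559424 * ε' ∧ 0 ≤ x ∧ x ≤ 5 / 2 * (83559424 * ε') ∧ η₀ = 8 * x ∧ 0 ≤ ω ∧ ω ≤ 15 / 2 * (83559424 * ε') ∧ κ = 8448 * ω ∧
      ((P.d : ℝ) + 1) * (P.L : ℝ) ^ k * ((((P.d * (P.L ^ k / 2) + P.L ^ k : ℕ)) : ℝ) * δ₀) = 4 * x ∧
      ((((P.d * (P.L ^ k / 2) + 2 * P.L ^ k : ℕ)) : ℝ) * δ₀) * (P.L : ℝ) ^ k ≤ 7 / 2 * (83559424 * ε') := by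
  obtain ⟨hh, hD, hD2, hcast⟩ := window_geom P k hd3
  set Lk : ℝ := (P.L : ℝ) ^ k with hLk
  have hL1 : (1 : ℝ) ≤ (P.L : ℝ) := by exact_mod_cast P.hL.2.le
  have hLk1 : 1 ≤ Lk := one_le_pow₀ hL1
  have hLk0 : 0 < Lk := by linarith
  -- `L^{2k}·δ₀ ≤ E`
  have hE : Lk ^ 2 * δ₀ ≤ 83559424 * ε' := by
    rw [hcast] at hδ₀B
    have h := mul_le_mul_of_nonneg_left hδ₀B (le_of_lt (pow_pos hLk0 2))
    rwa [mul_div_cancel₀ _ (pow_ne_zero 2 hLk0.ne')] at h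
  have hDδ : 0 ≤ (((P.d * (P.L ^ k / 2) + P.L ^ k : ℕ)) : ℝ) * δ₀ := by positivity
  have hx0 : 0 ≤ x := by rw [hx]; positivity
  have hxE : x ≤ 5 / 2 * (83559424 * ε') := by
    rw [hx]
    calc Lk * ((((P.d * (P.L ^ k / 2) + P.L ^ k : ℕ)) : ℝ) * δ₀) ≤ Lk * ((5 / 2 * Lk) * δ₀) :=
          mul_le_mul_of_nonneg_left (mul_le_mul_of_nonneg_right hD hδ₀) hLk0.le
      _ = 5 / 2 * (Lk ^ 2 * δ₀) := by ring
      _ ≤ 5 / 2 * (83559424 * ε') := by linarith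
  have hη8 : η₀ = 8 * x := by rw [hη₀, hx, hd3]; push_cast; ring
  have hω0 : 0 ≤ ω := by rw [hω]; positivity
  have hωE : ω ≤ 15 / 2 * (83559424 * ε') := by
    rw [hω]
    calc ((((P.d * (P.L ^ k / 2) + P.L ^ k : ℕ)) : ℝ) * δ₀ + (((P.d * (P.L ^ k / 2) + P.L ^ k : ℕ)) : ℝ) * δ₀) * (((P.d * (P.L ^ k / 2) : ℕ)) : ℝ)
        ≤ ((5 / 2 * Lk) * δ₀ + (5 / 2 * Lk) * δ₀) * (3 / 2 * Lk) :=
          mul_le_mul (add_le_add (mul_le_mul_of_nonneg_right hD hδ₀) (mul_le_mul_of_nonneg_right hD hδ₀)) hh (by positivity) (by positivity)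
      _ = 15 / 2 * (Lk ^ 2 * δ₀) := by ring
      _ ≤ 15 / 2 * (83559424 * ε') := by linarith
  have hκω : κ = 8448 * ω := by
    rw [hκ, hd3]; push_cast
    field_simp
    ring
  have h4x : ((P.d : ℝ) + 1) * Lk * ((((P.d * (P.L ^ k / 2) + P.L ^ k : ℕ)) : ℝ) * δ₀) = 4 * x := by rw [hx, hd3]; push_cast; ring
  have hpE : ((((P.d * (P.L ^ k / 2) + 2 * P.L ^ k : ℕ)) : ℝ) * δ₀) * Lk ≤ 7 / 2 * (83559424 * ε') := by
    calc ((((P.d * (P.L ^ k / 2) + 2 * P.L ^ k : ℕ)) : ℝ) * δ₀) * Lk ≤ ((7 / 2 * Lk) * δ₀) * Lk :=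
          mul_le_mul_of_nonneg_right (mul_le_mul_of_nonneg_right hD2 hδ₀) hLk0.le
      _ = 7 / 2 * (Lk ^ 2 * δ₀) := by ring
      _ ≤ 7 / 2 * (83559424 * ε') := by linarith
  exact ⟨hE, hx0, hxE, hη8, hω0, hωE, hκω, h4x, hpE⟩

/-! ## §3 The rows -/

/-- **★★ (K1)–(K7) OF `exists_exact_lift_regional_window_kfree` ON THE WINDOW** (`d = 3`, `3 ≤ L`, `|n| = 2`, `0 < ε′ ≤ 1∕(10³⁴L)`, `0 ≤ δ₀ ≤ 83559424ε′∕L^{2k}`; letters as in the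
module docstring, `C_R = 1056`), together with `0 < t ≤ 1∕4`, `0 ≤ x`, `0 ≤ η₀`, `0 ≤ κ`. [cite: Balaban1985Variational, Thm 1 (8) p.279, (11)–(15) pp.279–280; Balaban1985Averaging, Props. 4–5 pp.38–42] -/
theorem window_Krows (hd3 : P.d = 3) (hL3 : 3 ≤ P.L) {n : Type*} [Fintype n] (hn2 : Fintype.card n = 2) {ε' δ₀ t x η₀ ω κ : ℝ} (hε : 0 < ε')
    (hεL : ε' ≤ 1 / (10 ^ 34 * (P.L : ℝ))) (hδ₀ : 0 ≤ δ₀) (hδ₀B : δ₀ ≤ 83559424 * ε' / ((P.L ^ k : ℕ) : ℝ) ^ 2)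
    (hx : x = (P.L : ℝ) ^ k * ((((P.d * (P.L ^ k / 2) + P.L ^ k : ℕ)) : ℝ) * δ₀))
    (hη₀ : η₀ = 2 * (((P.d : ℝ) + 1) * (P.L : ℝ) ^ k * ((((P.d * (P.L ^ k / 2) + P.L ^ k : ℕ)) : ℝ) * δ₀)))
    (hω : ω = ((((P.d * (P.L ^ k / 2) + P.L ^ k : ℕ)) : ℝ) * δ₀ + (((P.d * (P.L ^ k / 2) + P.L ^ k : ℕ)) : ℝ) * δ₀) * (((P.d * (P.L ^ k / 2) : ℕ)) : ℝ))
    (hκ : κ = (((P.d : ℝ) + 1) * (P.L : ℝ) ^ k) * ((1056 / (P.L : ℝ) ^ k) * (2 * ω))) (ht : t = 84480 * (83559424 * ε')) :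
    0 < t ∧ t ≤ 1 / 4 ∧ 0 ≤ x ∧ 0 ≤ η₀ ∧ 0 ≤ κ ∧
    -- (K1)
    (((P.d : ℝ) + 1) * ((18 : ℝ) ^ P.d * (2 + ((P.d : ℝ) + 1) * (18 : ℝ) ^ P.d)) * (5200 * (((P.d + 2) * P.L : ℕ) : ℝ) ^ 2) / ((P.L : ℝ) * ((P.L : ℝ) - 1))) *
      (((P.d : ℝ) + 1) * (6 * t + x)) ≤ 1 ∧
    -- (K2)
    200 * (((P.d + 2) * P.L : ℕ) : ℝ) * (((P.d : ℝ) + 1) * (6 * t + x)) ≤ 1 ∧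
    -- (K3)
    4 * (((P.d + 2) * P.L : ℕ) : ℝ) * (((P.d : ℝ) + 1) * (6 * t + x)) < deltaSU n ∧
    -- (K4)
    4 * ((P.d : ℝ) + 1) * t + η₀ ≤ 1 / 4 ∧
    -- (K5)
    (Fintype.card n : ℝ) * (4 * ((P.d : ℝ) + 1) * t + η₀) < Real.pi ∧
    -- (K6)
    κ + ((P.d : ℝ) + 1) * 1056 *
      (8 * (4 * ((P.d : ℝ) + 1) * t + η₀) +
        2 * (((P.d : ℝ) + 1) * ((18 : ℝ) ^ P.d * (2 + ((P.d : ℝ) + 1) * (18 : ℝ) ^ P.d)) * (5200 * (((P.d + 2) * P.L : ℕ) : ℝ) ^ 2) / ((P.L : ℝ) * ((P.L : ℝ) - 1))) *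
          (((P.d : ℝ) + 1) * (6 * t + x)) +
        (2 * t + x) + (2 * (((P.d : ℝ) + 1) * x) + η₀)) ≤ 1 / 2 ∧
    -- (K7)
    4 * 1056 * η₀ ≤ t := by
  obtain ⟨-, -, -, hE3, hLE⟩ := window_eps P hL3 hε hεL
  obtain ⟨hfrac, -⟩ := window_frac P hd3 hL3
  obtain ⟨-, hx0, hxE, hη8, hω0, hωE, hκω, -, -⟩ := window_letters P k hd3 hδ₀ hδ₀B hx hη₀ hω hκ ht
  set E : ℝ := 83559424 * ε' with hEdef
  have hE0 : 0 < E := by positivity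
  have hL : (3 : ℝ) ≤ (P.L : ℝ) := by exact_mod_cast hL3
  have ht0 : 0 < t := by rw [ht]; positivity
  have hη0 : 0 ≤ η₀ := by rw [hη8]; positivity
  have hκ0 : 0 ≤ κ := by rw [hκω]; positivity
  -- the `δ_N` and `|n|` numerals at `|n| = 2`
  have hδN : deltaSU n = 1 / 3 := by
    unfold deltaSU; rw [hn2]; exact min_eq_left (by norm_num; linarith [Real.pi_gt_three])
  -- the shared letters
  have h6 : 6 * t + x ≤ 506883 * E := by rw [ht]; linarith
  have h6nn : 0 ≤ 6 * t + x := by linarith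
  have h16 : 4 * ((P.d : ℝ) + 1) * t + η₀ ≤ 1351700 * E := by rw [hd3, ht]; push_cast; linarith
  -- the big coefficient `C_A ≤ 106127236800000`
  have hCA : ((P.d : ℝ) + 1) * ((18 : ℝ) ^ P.d * (2 + ((P.d : ℝ) + 1) * (18 : ℝ) ^ P.d)) * (5200 * (((P.d + 2) * P.L : ℕ) : ℝ) ^ 2) / ((P.L : ℝ) * ((P.L : ℝ) - 1)) ≤
      106127236800000 := by
    rw [mul_div_assoc]
    have hA : ((P.d : ℝ) + 1) * ((18 : ℝ) ^ P.d * (2 + ((P.d : ℝ) + 1) * (18 : ℝ) ^ P.d)) = 544242240 := by rw [hd3]; norm_num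
    rw [hA]
    linarith
  have hCA0 : 0 ≤ ((P.d : ℝ) + 1) * ((18 : ℝ) ^ P.d * (2 + ((P.d : ℝ) + 1) * (18 : ℝ) ^ P.d)) * (5200 * (((P.d + 2) * P.L : ℕ) : ℝ) ^ 2) / ((P.L : ℝ) * ((P.L : ℝ) - 1)) := by
    have hden : (0 : ℝ) < (P.L : ℝ) * ((P.L : ℝ) - 1) := by nlinarith
    positivity
  have hd1 : ((P.d : ℝ) + 1) * (6 * t + x) ≤ 4 * (506883 * E) := by rw [hd3]; push_cast; linarith
  have hd1nn : 0 ≤ ((P.d : ℝ) + 1) * (6 * t + x) := by positivity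
  have hK1' : ((P.d : ℝ) + 1) * ((18 : ℝ) ^ P.d * (2 + ((P.d : ℝ) + 1) * (18 : ℝ) ^ P.d)) * (5200 * (((P.d + 2) * P.L : ℕ) : ℝ) ^ 2) / ((P.L : ℝ) * ((P.L : ℝ) - 1)) *
      (((P.d : ℝ) + 1) * (6 * t + x)) ≤ 106127236800000 * (4 * (506883 * E)) := mul_le_mul hCA hd1 hd1nn (by norm_num)
  have hℓ : (((P.d + 2) * P.L : ℕ) : ℝ) = 5 * (P.L : ℝ) := by rw [hd3]; push_cast; ring
  refine ⟨ht0, ?_, hx0, hη0, hκ0, ?_, ?_, ?_, ?_, ?_, ?_, ?_⟩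
  · rw [ht]; linarith
  · linarith
  · rw [hℓ]
    calc 200 * (5 * (P.L : ℝ)) * (((P.d : ℝ) + 1) * (6 * t + x)) ≤ 200 * (5 * (P.L : ℝ)) * (4 * (506883 * E)) := mul_le_mul_of_nonneg_left hd1 (by positivity)
      _ = 4000 * 506883 * ((P.L : ℝ) * E) := by ring
      _ ≤ 1 := by linarith
  · rw [hℓ, hδN]
    calc 4 * (5 * (P.L : ℝ)) * (((P.d : ℝ) + 1) * (6 * t + x)) ≤ 4 * (5 * (P.L : ℝ)) * (4 * (506883 * E)) := mul_le_mul_of_nonneg_left hd1 (by positivity)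
      _ = 80 * 506883 * ((P.L : ℝ) * E) := by ring
      _ < 1 / 3 := by linarith
  · linarith
  · rw [hn2]; push_cast; linarith [Real.pi_gt_three]
  · rw [hκω]
    have h2tx : 2 * t + x ≤ 168963 * E := by rw [ht]; linarith
    have h8x : 2 * (((P.d : ℝ) + 1) * x) + η₀ ≤ 40 * E := by rw [hη8, hd3]; push_cast; linarith
    have hin : 8 * (4 * ((P.d : ℝ) + 1) * t + η₀) +
        2 * (((P.d : ℝ) + 1) * ((18 : ℝ) ^ P.d * (2 + ((P.d : ℝ) + 1) * (18 : ℝ) ^ P.d)) * (5200 * (((P.d + 2) * P.L : ℕ) : ℝ) ^ 2) / ((P.L : ℝ) * ((P.L : ℝ) - 1))) *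
          (((P.d : ℝ) + 1) * (6 * t + x)) + (2 * t + x) + (2 * (((P.d : ℝ) + 1) * x) + η₀) ≤
        8 * (1351700 * E) + 2 * (106127236800000 * (4 * (506883 * E))) + 168963 * E + 40 * E := by linarith
    have hd4 : ((P.d : ℝ) + 1) * 1056 = 4224 := by rw [hd3]; norm_num
    rw [hd4]
    linarith
  · rw [hη8, ht]; linarith

/-- **★ THE THREE (S6) ROWS OF `startT3_cert` ON THE WINDOW** (`hm`, `h32`, `hNδ` at `b′ := δ₀`; `d = 3`, `3 ≤ L`, `|n| = 2`). [cite: Balaban1985Variational, Thm 1 (8) p.279, (11)–(13) pp.279–280] -/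
theorem window_S6rows (hd3 : P.d = 3) (hL3 : 3 ≤ P.L) {n : Type*} [Fintype n] (hn2 : Fintype.card n = 2) {ε' δ₀ : ℝ} (hε : 0 < ε') (hεL : ε' ≤ 1 / (10 ^ 34 * (P.L : ℝ)))
    (hδ₀ : 0 ≤ δ₀) (hδ₀B : δ₀ ≤ 83559424 * ε' / ((P.L ^ k : ℕ) : ℝ) ^ 2) :
    (((P.d : ℝ) + 1) * ((18 : ℝ) ^ P.d * (2 + ((P.d : ℝ) + 1) * (18 : ℝ) ^ P.d)) * (324 * (((P.d + 2) * P.L : ℕ) : ℝ) ^ 2) / ((P.L : ℝ) * ((P.L : ℝ) - 1))) *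
        (((P.d : ℝ) + 1) * (P.L : ℝ) ^ k * ((((P.d * (P.L ^ k / 2) + P.L ^ k : ℕ)) : ℝ) * δ₀)) ≤ 1 ∧
    32 * (((P.d + 2) * P.L : ℕ) : ℝ) * (((P.d : ℝ) + 1) * (P.L : ℝ) ^ k * ((((P.d * (P.L ^ k / 2) + P.L ^ k : ℕ)) : ℝ) * δ₀)) ≤ 1 ∧
    4 * (((P.d + 2) * P.L : ℕ) : ℝ) * (((P.d : ℝ) + 1) * (P.L : ℝ) ^ k * ((((P.d * (P.L ^ k / 2) + P.L ^ k : ℕ)) : ℝ) * δ₀)) < deltaSU n := by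
  obtain ⟨-, -, -, hE3, hLE⟩ := window_eps P hL3 hε hεL
  obtain ⟨-, hfrac⟩ := window_frac P hd3 hL3
  obtain ⟨-, hx0, hxE, -, -, -, -, h4x, -⟩ := window_letters P k hd3 hδ₀ hδ₀B rfl rfl rfl rfl rfl
  set E : ℝ := 83559424 * ε' with hEdef
  set x : ℝ := (P.L : ℝ) ^ k * ((((P.d * (P.L ^ k / 2) + P.L ^ k : ℕ)) : ℝ) * δ₀) with hxdef
  have hL : (3 : ℝ) ≤ (P.L : ℝ) := by exact_mod_cast hL3
  have hδN : deltaSU n = 1 / 3 := by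
    unfold deltaSU; rw [hn2]; exact min_eq_left (by norm_num; linarith [Real.pi_gt_three])
  have hℓ : (((P.d + 2) * P.L : ℕ) : ℝ) = 5 * (P.L : ℝ) := by rw [hd3]; push_cast; ring
  rw [h4x]
  have hC : ((P.d : ℝ) + 1) * ((18 : ℝ) ^ P.d * (2 + ((P.d : ℝ) + 1) * (18 : ℝ) ^ P.d)) * (324 * (((P.d + 2) * P.L : ℕ) : ℝ) ^ 2) / ((P.L : ℝ) * ((P.L : ℝ) - 1)) ≤
      544242240 * 12150 := by
    rw [mul_div_assoc]
    have hA : ((P.d : ℝ) + 1) * ((18 : ℝ) ^ P.d * (2 + ((P.d : ℝ) + 1) * (18 : ℝ) ^ P.d)) = 544242240 := by rw [hd3]; norm_num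
    rw [hA]
    exact mul_le_mul_of_nonneg_left hfrac (by norm_num)
  have hLx : (P.L : ℝ) * x ≤ (P.L : ℝ) * (5 / 2 * E) := mul_le_mul_of_nonneg_left hxE (by positivity)
  refine ⟨?_, ?_, ?_⟩
  · calc _ ≤ (544242240 * 12150 : ℝ) * (4 * x) := mul_le_mul_of_nonneg_right hC (by positivity)
      _ ≤ 1 := by linarith
  · rw [hℓ]
    calc 32 * (5 * (P.L : ℝ)) * (4 * x) = 640 * ((P.L : ℝ) * x) := by ring
      _ ≤ 1 := by linarith
  · rw [hℓ, hδN]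
    calc 4 * (5 * (P.L : ℝ)) * (4 * x) = 80 * ((P.L : ℝ) * x) := by ring
      _ < 1 / 3 := by linarith

/-- **★ THE SCALE ROWS OF `exists_exact_lift_regional_window_kfree` ON THE WINDOW**: `δ₀ ≤ B₀·(ε′∕(L^k)²)` (`B₀ = 83559424`), `η₀ ≤ A₀ε′` (`A₀ = 1671188480`), `η_p ≤ A₁·(ε′∕L^k)`
(`A₁ = 292457984`, `η_p = D₂δ₀`), the curl constant `C_curl := 1728 + 12672(η_p·L^k) ≤ 1729`, and the plaquette constant `B₀ + 4C_curl A₀ + 64·1056·A₁A₀ + 256·1056²A₀² < 10²⁷`.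
[cite: Balaban1985Variational, Thm 1 (8) p.279, (15) p.280] -/
theorem window_scales (hd3 : P.d = 3) (hL3 : 3 ≤ P.L) {ε' δ₀ : ℝ} (hε : 0 < ε') (hεL : ε' ≤ 1 / (10 ^ 34 * (P.L : ℝ))) (hδ₀ : 0 ≤ δ₀)
    (hδ₀B : δ₀ ≤ 83559424 * ε' / ((P.L ^ k : ℕ) : ℝ) ^ 2) :
    δ₀ ≤ 83559424 * (ε' / ((P.L : ℝ) ^ k) ^ 2) ∧
    2 * (((P.d : ℝ) + 1) * (P.L : ℝ) ^ k * ((((P.d * (P.L ^ k / 2) + P.L ^ k : ℕ)) : ℝ) * δ₀)) ≤ 1671188480 * ε' ∧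
    (((P.d * (P.L ^ k / 2) + 2 * P.L ^ k : ℕ)) : ℝ) * δ₀ ≤ 292457984 * (ε' / (P.L : ℝ) ^ k) ∧
    1728 + 12672 * (((((P.d * (P.L ^ k / 2) + 2 * P.L ^ k : ℕ)) : ℝ) * δ₀) * (P.L : ℝ) ^ k) ≤ 1729 ∧
    (83559424 : ℝ) + 4 * (1728 + 12672 * (((((P.d * (P.L ^ k / 2) + 2 * P.L ^ k : ℕ)) : ℝ) * δ₀) * (P.L : ℝ) ^ k)) * 1671188480 + 64 * 1056 * 292457984 * 1671188480 +
        256 * 1056 ^ 2 * 1671188480 ^ 2 < 10 ^ 27 := by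
  obtain ⟨-, -, -, hE3, -⟩ := window_eps P hL3 hε hεL
  obtain ⟨-, -, hxE, hη8, -, -, -, -, hpE⟩ := window_letters P k hd3 hδ₀ hδ₀B rfl rfl rfl rfl rfl
  obtain ⟨-, -, -, hcast⟩ := window_geom P k hd3
  set E : ℝ := 83559424 * ε' with hEdef
  have hL1 : (1 : ℝ) ≤ (P.L : ℝ) := by exact_mod_cast P.hL.2.le
  have hLk0 : 0 < (P.L : ℝ) ^ k := by positivity
  refine ⟨?_, ?_, ?_, by linarith, by linarith⟩
  · rw [hcast] at hδ₀B
    calc δ₀ ≤ 83559424 * ε' / ((P.L : ℝ) ^ k) ^ 2 := hδ₀B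
      _ = 83559424 * (ε' / ((P.L : ℝ) ^ k) ^ 2) := by ring
  · rw [hη8]; linarith
  · rw [show (292457984 : ℝ) * (ε' / (P.L : ℝ) ^ k) = 292457984 * ε' / (P.L : ℝ) ^ k by ring, le_div_iff₀ hLk0]
    calc (((P.d * (P.L ^ k / 2) + 2 * P.L ^ k : ℕ)) : ℝ) * δ₀ * (P.L : ℝ) ^ k ≤ 7 / 2 * E := hpE
      _ = 292457984 * ε' := by rw [hEdef]; ring

end Summit.QuantumFields.YangMills.Theorems.TubeStart

end
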